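import Summits.QuantumFields.YangMills.Theorems.LuscherReductionTwistedTraceScalingBOLocalisedAvgChartUpper
import Summits.QuantumFields.YangMills.Theorems.LuscherReductionTwistedTraceScalingBOCoreComplement
import HarnessLib

/-!
# (C1c'-ξ) ★★★ THE LOCALISED AVERAGE OF THE BO FUNCTION OF RECORD IS GAUSSIAN FROM BELOW NEAR INNER-CORE FIBRE POINTS — hAlo of the (C1) glue, modulo (P) and the toolchain
# smallness conditions; the core-complement part is EXACTLY zero there
# (lane A of S-BASE, crux `TwistedTraceScaling` stmt-QuantumFields-20203, C4-CORE, the (OD) pen; assembly of (4')+(5) of `pub/ym-fleet/ym-luscher-20007-p1/COARSE-DESIGN.md` §28.5)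

* §1 ★ `norm_rep_le_refined` — the REFINED size of the slice representative of a chart point: `‖linkEmbed p*.1‖ ≤ ‖chartVec w‖ + 14|E|ρ² + D'` (`D' = O(Kρ²)`), instead of the crude
  `+ 7|E|ρ + 9BKρ` of `chart_rep_transfer`: the relative coordinate is automatically BALANCED (`…PolarMean.sum_vecPart_mul_polarMean_inv`, so the `O(ρ)` constant mode of the chart point
  is orthogonal to it) and `x* = P_{Γ⊥}(x* )` kills the leading gauge displacement `−∇ξ'` — this is what lets the profile-radius condition `‖x*‖ + D ≤ r_f` hold up to `‖chartVec w‖ ≈ r_f`;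
* §2 ★★★ `localisedAvg_chart_lower` — for chart points with `‖chartVec w‖ ≤ R_w`, given (P) from below `N_lo ≤ N` on the fat tube, the window floor `χ_lo ≤ χ₀(u)` for one-site `u` with
  `‖q(u_k) − 1‖ ≤ 5Mδ`, `S₁(u) ≤ 12(5Mδ)⁴`, the profile radius `R_w + 14|E|ρ² + D' + D ≤ r_f β`, the step-(5) radii of `…BOCoreComplement` (`3(L−1)(ρ₁+Mδ) ≤ 1/3`,
  `32C_L(R_w + 14|E|ρ² + r_fβ) < R₁'`) and `T_b ≤ N_lo`:  `Z·χ_lo·e^{−(ε_q+ε_tr)}·(N_lo − T_b)·e^{−q_{t,b}(chartVec w)} ≤ A(P w)`.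
With the upper half this is (C1c') = hAlo/hAhi of `…BOCentralTube.central_transfer_two_sided_of_localisedAvg_local`, modulo (P) (`…FPWeightCore.fpWeight_core_constant_pow`) and rates.
HONEST FRAMING: assembly for a stub of a child of the CONDITIONAL route R2b1; (C1) packaging/rates, (C4), (C5), (B-ST) OPEN; C4-CORE OPEN; not infinite volume, not a gap, not Clay.
-/

set_option autoImplicit false

noncomputable section

open MeasureTheory Real
open scoped BigOperators RealInnerProductSpace
open Literature.MathematicalPhysics.QuantumFieldTheory
open Literature.MathematicalPhysics.QuantumLattice

namespace Summit.QuantumFields.YangMills.Theorems.FemtoTransferGap.TwoLattice.ConstTube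

open Summit.QuantumFields.YangMills.Theorems.FemtoTransferGap
open Summit.QuantumFields.YangMills.Theorems.FemtoTransferGap.TwoLattice
open Summit.QuantumFields.YangMills.Theorems.FemtoTransferGap.TwoLattice.Avg
open Summit.QuantumFields.YangMills.Theorems.FemtoTransferGap.TwoLattice.Stiff
open Summit.QuantumFields.YangMills.Theorems.FemtoTransferGap.TwoLattice.GnChart
open Literature.MathematicalPhysics.QuantumFieldTheory.Balaban1983to89.T4CubeChartGnomonic (gnoPoint)

variable {L : ℕ} [NeZero L]

/-! ## §1 ★ The refined size of the slice representative -/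

/-- The relative coordinate of a chart point is orthogonal to every constant mode (automatic balance). [folklore] -/
theorem inner_relLinkVec_constMode_eq_zero {ρ : ℝ} (hρ0 : 0 ≤ ρ) (hρ1 : ρ ≤ 1) {w : Edge 3 L → Fin 3 → ℝ} (hw : ∀ e, ∑ a, w e a ^ 2 ≤ ρ ^ 2) (c : Fin 3 → Fin 3 → ℝ) :
    ⟪relLinkVec L (latPatternChart L (fun _ => false) w), (WithLp.toLp 2 fun ea : Edge 3 L × Fin 3 => c ea.1.2 ea.2 : LinkSpace L)⟫ = 0 := by
  set V := latPatternChart L (fun _ => false) w with hV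
  have hdir : ∀ k : Fin 3, dirQuat L k V ≠ 0 := fun k => by
    refine dirQuat_ne_zero_of_scalarSum_pos L ?_
    unfold dirScalarSum
    refine Finset.sum_pos (fun x _ => ?_) Finset.univ_nonempty
    have h := (latPatternChart_link_data hρ0 hw (x, k)).1
    have : ρ ^ 2 ≤ 1 := by nlinarith
    linarith
  rw [PiLp.inner_apply]
  simp only [RCLike.inner_apply, conj_trivial]
  rw [Fintype.sum_prod_type, Fintype.sum_prod_type, Finset.sum_comm]
  refine Finset.sum_eq_zero fun k _ => ?_
  rw [Finset.sum_comm]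
  refine Finset.sum_eq_zero fun a _ => ?_
  have h := sum_vecPart_mul_polarMean_inv_apply L (hdir k) a
  have h' : ∑ x : Site 3 L, relLinkVec L V ((x, k), a) = 0 := h
  rw [show (∑ x : Site 3 L, c k a * relLinkVec L V ((x, k), a)) = c k a * ∑ x : Site 3 L, relLinkVec L V ((x, k), a) by rw [Finset.mul_sum], h', mul_zero]

/-- `‖relLinkVec (P w)‖ ≤ ‖chartVec w‖ + 14|E|ρ²` on the chart ball (`0 ≤ ρ ≤ 1/5`): the constant mode drops out by orthogonality, the remainder is `≤ 7ρ²` per component. [folklore] -/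
theorem norm_relLinkVec_latPatternChart_le {ρ : ℝ} (hρ0 : 0 ≤ ρ) (hρ5 : ρ ≤ 1 / 5) {w : Edge 3 L → Fin 3 → ℝ} (hw : ∀ e, ∑ a, w e a ^ 2 ≤ ρ ^ 2) :
    ‖relLinkVec L (latPatternChart L (fun _ => false) w)‖ ≤ ‖chartVec w‖ + 14 * Fintype.card (Edge 3 L) * ρ ^ 2 := by
  set V := latPatternChart L (fun _ => false) w with hV
  set E : ℝ := (Fintype.card (Edge 3 L) : ℝ) with hEdef
  have hE1 : 1 ≤ E := by rw [hEdef]; exact_mod_cast Fintype.card_pos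
  set κ : LinkSpace L := WithLp.toLp 2 fun ea : Edge 3 L × Fin 3 => vecPart (polarMean L ea.1.2 V) ea.2 with hκ
  set Rem : LinkSpace L := chartVec w - relLinkVec L V - κ with hRem
  have hcomp : ∀ ea : Edge 3 L × Fin 3, |Rem ea| ≤ 7 * ρ ^ 2 := fun ea => by
    obtain ⟨e, a⟩ := ea
    exact relLinkVec_chart_decomposition hρ0 hρ5 hw e a
  have hsq : ‖Rem‖ ^ 2 ≤ (14 * E * ρ ^ 2) ^ 2 := by
    rw [EuclideanSpace.norm_sq_eq]
    calc ∑ ea, ‖Rem ea‖ ^ 2 ≤ ∑ _ea : Edge 3 L × Fin 3, (7 * ρ ^ 2) ^ 2 := Finset.sum_le_sum fun ea _ => by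
          rw [Real.norm_eq_abs]; exact pow_le_pow_left₀ (abs_nonneg _) (hcomp ea) 2
      _ = 3 * E * (7 * ρ ^ 2) ^ 2 := by rw [Finset.sum_const, Finset.card_univ, Fintype.card_prod, Fintype.card_fin, nsmul_eq_mul]; push_cast; rw [hEdef]; ring
      _ ≤ (14 * E * ρ ^ 2) ^ 2 := by nlinarith [sq_nonneg (ρ ^ 2), sq_nonneg E]
  have hRemle : ‖Rem‖ ≤ 14 * E * ρ ^ 2 := (pow_le_pow_iff_left₀ (norm_nonneg _) (by positivity) two_ne_zero).1 hsq
  -- `relLinkVec V + κ = chartVec w − Rem`, `relLinkVec V ⊥ κ`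
  have hsum : relLinkVec L V + κ = chartVec w - Rem := by rw [hRem]; abel
  have horth : ⟪relLinkVec L V, κ⟫ = 0 := inner_relLinkVec_constMode_eq_zero hρ0 (by linarith) hw (fun k a => vecPart (polarMean L k V) a)
  have hpy : ‖relLinkVec L V + κ‖ ^ 2 = ‖relLinkVec L V‖ ^ 2 + ‖κ‖ ^ 2 := by
    rw [norm_add_sq_real, horth, mul_zero, add_zero]
  have h1 : ‖relLinkVec L V‖ ^ 2 ≤ ‖chartVec w - Rem‖ ^ 2 := by rw [← hsum, hpy]; nlinarith [sq_nonneg ‖κ‖]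
  have h2 : ‖relLinkVec L V‖ ≤ ‖chartVec w - Rem‖ := (pow_le_pow_iff_left₀ (norm_nonneg _) (norm_nonneg _) two_ne_zero).1 h1
  exact h2.trans ((norm_sub_le _ _).trans (by linarith))

/-- ★ **THE REFINED SIZE OF THE SLICE REPRESENTATIVE**: for `P(w) = c·(tubePt p)^{P∘ξ'}` as in `chartPoint_slice_rep` (`‖ξ'‖ ≤ 9Kρ`, `‖p‖ ≤ (4+48K)ρ`, `p` on the slice):
`‖linkEmbed p.1‖ ≤ ‖chartVec w‖ + 14|E|ρ² + D'`, `D' = 9C_LK(4+48K)ρ² + 81M_TK²ρ²` (`x* = P_{Γ⊥}x*` kills the leading gauge displacement `−∇ξ'`; the constant mode is ⊥ `relLinkVec`). [folklore] -/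
theorem norm_rep_le_refined {K ρ : ℝ} (hK : 0 ≤ K) (hρ0 : 0 ≤ ρ) (hρ5 : ρ ≤ 1 / 5)
    {w : Edge 3 L → Fin 3 → ℝ} (hw : ∀ e, ∑ a, w e a ^ 2 ≤ ρ ^ 2)
    {c : SU2} {ξ' : basedSubmodule L} {p : balancedSubmodule L × (Fin 3 → Fin 3 → ℝ)}
    (hrep : latPatternChart L (fun _ => false) w = gaugeTransform (fun _ : Site 3 L => c) (gaugeTransform (fun x => chartSU2 ((ξ' : Site 3 L → Fin 3 → ℝ) x)) (tubePt L p)))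
    (hξ' : ‖ξ'‖ ≤ 9 * K * ρ) (hpn : ‖p‖ ≤ (4 + 48 * K) * ρ) (hslice : (gaugeModes L).starProjection (linkEmbed L (p.1 : Edge 3 L → Fin 3 → ℝ)) = 0)
    {εT MT : ℝ} (hMT : 0 ≤ MT)
    (hT : ∀ (ξ : basedSubmodule L) (q : balancedSubmodule L × (Fin 3 → Fin 3 → ℝ)), ‖ξ‖ < εT → ‖q‖ < εT →
      ‖basedFn L (ξ, q) - basedFn L (0, q) - basedLin L q ξ‖ ≤ MT * ‖ξ‖ ^ 2)
    {CL εL : ℝ} (hCL : 0 ≤ CL)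
    (hLip : ∀ q : balancedSubmodule L × (Fin 3 → Fin 3 → ℝ), ‖q‖ < εL → ∀ ξ : basedSubmodule L, ‖(basedLin L q - basedLin L 0) ξ‖ ≤ CL * ‖q‖ * ‖ξ‖)
    (h1 : (4 + 48 * K) * ρ < εT) (h2 : (4 + 48 * K) * ρ < εL) (h4 : (4 + 48 * K) * ρ ≤ 1 / 40) (h5 : 9 * K * ρ < εT) :
    ‖linkEmbed L (p.1 : Edge 3 L → Fin 3 → ℝ)‖ ≤ ‖chartVec w‖ + 14 * Fintype.card (Edge 3 L) * ρ ^ 2 + (CL * ((4 + 48 * K) * ρ) * (9 * K * ρ) + MT * (9 * K * ρ) ^ 2) := by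
  set V := latPatternChart L (fun _ => false) w with hV
  set x' : LinkSpace L := linkEmbed L (p.1 : Edge 3 L → Fin 3 → ℝ) with hx'
  have hpT : ‖p‖ < εT := lt_of_le_of_lt hpn h1
  have hpL : ‖p‖ < εL := lt_of_le_of_lt hpn h2
  have hp40 : ‖p‖ ≤ 1 / 40 := hpn.trans h4
  have hξT : ‖ξ'‖ < εT := lt_of_le_of_lt hξ' h5
  have hp1 : ‖p.1‖ ≤ 1 / 20 := (norm_fst_le p).trans (by linarith)
  have hp2 : ‖p.2‖ ≤ 1 / 40 := (norm_snd_le p).trans hp40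
  have hfB0 : basedFn L (0, p) = x' := basedFn_zero_left L p hp1 hp2
  -- `‖basedFn(ξ',p)‖ = ‖relLinkVec V‖ ≤ ‖chartVec w‖ + 14|E|ρ²`
  have hrel : relLinkVec L V = adL L c (basedFn L (ξ', p)) := by rw [hrep, relLinkVec_conj, relLinkVec_gaugeTransform_tubePt]
  have hnb : ‖basedFn L (ξ', p)‖ ≤ ‖chartVec w‖ + 14 * Fintype.card (Edge 3 L) * ρ ^ 2 := by
    have : ‖relLinkVec L V‖ = ‖basedFn L (ξ', p)‖ := by rw [hrel, LinearIsometryEquiv.norm_map]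
    rw [← this]; exact norm_relLinkVec_latPatternChart_le hρ0 hρ5 hw
  -- `x* = y + ∇ξ'`, `y = basedFn − (basedLin p − basedLin 0)ξ' − Err`
  set Err : LinkSpace L := basedFn L (ξ', p) - x' - basedLin L p ξ' with hErr
  have hErr_le : ‖Err‖ ≤ MT * ‖ξ'‖ ^ 2 := by have h := hT ξ' p hξT hpT; rw [hfB0] at h; exact h
  set y : LinkSpace L := basedFn L (ξ', p) - (basedLin L p - basedLin L 0) ξ' - Err with hy
  have hdec : x' = y + vacGrad L (ξ' : Site 3 L → Fin 3 → ℝ) := by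
    have e1 : basedLin L p ξ' = (basedLin L p - basedLin L 0) ξ' + basedLin L 0 ξ' := by rw [FunLike.coe_sub, Pi.sub_apply, sub_add_cancel]
    rw [hy, hErr, e1, basedLin_zero]; abel
  have hPgrad : (gaugeModes L).starProjection (vacGrad L (ξ' : Site 3 L → Fin 3 → ℝ)) = vacGrad L (ξ' : Site 3 L → Fin 3 → ℝ) :=
    Submodule.starProjection_eq_self_iff.2 (LinearMap.mem_range_self _ _)
  have hx'eq : x' = y - (gaugeModes L).starProjection y := by
    have e : x' = x' - (gaugeModes L).starProjection x' := by rw [hslice, sub_zero]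
    rw [e, hdec, map_add, hPgrad]; abel
  have hPy : ‖y - (gaugeModes L).starProjection y‖ ≤ ‖y‖ := by
    have e : (gaugeModes L)ᗮ.starProjection y = y - (gaugeModes L).starProjection y := Submodule.starProjection_orthogonal_val y
    rw [← e]; exact Submodule.norm_starProjection_apply_le _ _
  have hy_le : ‖y‖ ≤ ‖basedFn L (ξ', p)‖ + CL * ‖p‖ * ‖ξ'‖ + MT * ‖ξ'‖ ^ 2 := by
    have f1 : ‖(basedLin L p - basedLin L 0) ξ'‖ ≤ CL * ‖p‖ * ‖ξ'‖ := hLip p hpL ξ'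
    have f2 : ‖basedFn L (ξ', p) - (basedLin L p - basedLin L 0) ξ'‖ ≤ ‖basedFn L (ξ', p)‖ + ‖(basedLin L p - basedLin L 0) ξ'‖ := norm_sub_le _ _
    have f3 : ‖y‖ ≤ ‖basedFn L (ξ', p) - (basedLin L p - basedLin L 0) ξ'‖ + ‖Err‖ := by rw [hy]; exact norm_sub_le _ _
    linarith
  -- sizes of the corrections
  have hsq : ‖ξ'‖ ^ 2 ≤ (9 * K * ρ) ^ 2 := pow_le_pow_left₀ (norm_nonneg _) hξ' 2
  have e1 : CL * ‖p‖ * ‖ξ'‖ ≤ CL * ((4 + 48 * K) * ρ) * (9 * K * ρ) := by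
    have := mul_le_mul hpn hξ' (norm_nonneg _) (by positivity : (0 : ℝ) ≤ (4 + 48 * K) * ρ)
    calc CL * ‖p‖ * ‖ξ'‖ = CL * (‖p‖ * ‖ξ'‖) := by ring
      _ ≤ CL * ((4 + 48 * K) * ρ * (9 * K * ρ)) := mul_le_mul_of_nonneg_left this hCL
      _ = _ := by ring
  have e2 : MT * ‖ξ'‖ ^ 2 ≤ MT * (9 * K * ρ) ^ 2 := mul_le_mul_of_nonneg_left hsq hMT
  have hfin : ‖x'‖ = ‖y - (gaugeModes L).starProjection y‖ := by rw [← hx'eq]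
  linarith

/-! ## §2 ★★★ The lower Gaussian bound near inner-core fibre points -/
set_option maxHeartbeats 400000 in
/-- ★★★ **(C1c') LOWER HALF: THE LOCALISED AVERAGE OF THE BO FUNCTION OF RECORD IS GAUSSIAN FROM BELOW AT THE CHART POINTS WITH `‖chartVec w‖ ≤ R_w`.**  Hypotheses: those of
`localisedAvg_chart_upper`, a lower bound `N_lo ≤ N` on the fat tube ((P)), the window floor `χ_lo ≤ χ₀(u)` for one-site configurations with `‖q(u_k) − 1‖ ≤ 5Mδ` and `S₁(u) ≤ 12(5Mδ)⁴`
(`δ = Kβ^{-s}`, `Mδ ≤ 1/4`, `r ≤ 1/2`), the profile radius `R_w + (7|E|ρ + 9BK_{sp}ρ + M_T(9K_{sp}ρ)²) + (Br + M_Tr²) ≤ r_f β`, the step-(5) conditions of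
`…BOCoreComplement.integral_coreComplement_eq_zero` (based radius `3(L−1)(ρ₁ + Mδ) ≤ 1/3`, jump radius `32C_L(R_w + 14|E|ρ² + r_f β) < R₁'` — the core-complement part VANISHES), and
`T_b ≤ N_lo`.  Then `Z·χ_lo·e^{−(ε_q+ε_tr)}·(N_lo − T_b)·e^{−q_{t,b}(chartVec w)} ≤ A(P w)`. [cite: Luscher1983, §3] -/
theorem localisedAvg_chart_lower (hL : Nonempty (NzSite L)) {s K M : ℝ} {β : ℝ} (hs1 : 0 < powScale 1 β)
    -- the toolchain
    {Ksp εsp : ℝ} (hKsp : 0 ≤ Ksp)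
    (hSP : ∀ w : Edge 3 L → Fin 3 → ℝ, w ∈ balancedSet L → ∀ c : Fin 3 → Fin 3 → ℝ, ‖w‖ < εsp → ‖c‖ < εsp →
      ∃ ξ : Site 3 L → Fin 3 → ℝ, ∑ x : Site 3 L, ξ x = 0 ∧ ‖ξ‖ ≤ Ksp * ‖w‖ ∧
        gaugeCoordSq L (gaugeTransform (fun x => chartSU2 (ξ x)) (orthoTube L (fun e₁ => chartSU2 (c e₁.2)) w)) = 0)
    {εT MT : ℝ} (hMT : 0 ≤ MT) (hεT : 0 < εT)
    (hT : ∀ (ξ : basedSubmodule L) (q : balancedSubmodule L × (Fin 3 → Fin 3 → ℝ)), ‖ξ‖ < εT → ‖q‖ < εT →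
      ‖basedFn L (ξ, q) - basedFn L (0, q) - basedLin L q ξ‖ ≤ MT * ‖ξ‖ ^ 2)
    {εC : ℝ} (hC : ∀ q : balancedSubmodule L × (Fin 3 → Fin 3 → ℝ), ‖q‖ < εC →
      ∀ ξ : basedSubmodule L, ‖ξ‖ ≤ 4 * sliceConst L * ‖(gaugeModes L).starProjection (basedLin L q ξ)‖)
    {εI : ℝ} (hI : ∀ q : balancedSubmodule L × (Fin 3 → Fin 3 → ℝ), ‖q‖ < εI → ∀ {a s' : ℝ}, 0 < a → 0 < s' →
      ∫ w, Real.exp (-(a * ‖laplaceMap L q w‖ ^ 2 / s' ^ 2)) ∂(volume : Measure (NzSite L → Fin 3 → ℝ)) =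
        (π * s' ^ 2 / a) ^ (flatDim L / 2 : ℝ) / Real.sqrt (gramDet L q))
    {KD εD : ℝ} (hKD : 0 ≤ KD) (hD : ∀ q : balancedSubmodule L × (Fin 3 → Fin 3 → ℝ), ‖q‖ < εD → |gramDet L q / gramDet L 0 - 1| ≤ KD * ‖q‖ ^ 2)
    {B εB : ℝ} (hB0 : 0 ≤ B) (hB : ∀ q : balancedSubmodule L × (Fin 3 → Fin 3 → ℝ), ‖q‖ < εB → ‖basedLin L q‖ ≤ B)
    {CL εL : ℝ} (hCL : 0 ≤ CL)
    (hLip : ∀ q : balancedSubmodule L × (Fin 3 → Fin 3 → ℝ), ‖q‖ < εL → ∀ ξ : basedSubmodule L, ‖(basedLin L q - basedLin L 0) ξ‖ ≤ CL * ‖q‖ * ‖ξ‖)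
    -- the profile, the amplitude, the weight
    {t b : ℝ} (ht : 0 ≤ t) (hb : 0 ≤ b) {qf : ℝ → LinkSpace L → ℝ} (hqfm : ∀ β', Measurable (qf β')) (hqf0 : ∀ β' x, 0 ≤ qf β' x)
    (hqfinv : ∀ β' (g : SU2) (x : LinkSpace L), qf β' (adL L g x) = qf β' x) (hqf : qf β = stiffGaussExp L t b) {rf : ℝ → ℝ}
    {χ₀ : GaugeConfig 3 1 SU2 → ℝ} (hχm : Measurable χ₀) {Cχ : ℝ} (hχ0 : ∀ u, 0 ≤ χ₀ u) (hCχ : ∀ u, χ₀ u ≤ Cχ)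
    (hχinv : ∀ (c : SU2) (u : GaugeConfig 3 1 SU2), χ₀ (gaugeTransform (fun _ : Site 3 1 => c) u) = χ₀ u)
    (hbo : ∀ U, boFun L χ₀ (frozenProfile L qf rf β) U ≠ 0 → recordChi L s K M β U ≠ 0)
    (ε R₁' : ℝ) {Z : ℝ} (hZ0 : 0 ≤ Z) (hZ : ∀ g : Site 3 L → SU2, ∫ c, fpWeight L ε (fun x => c * g x) ∂haarProbability SU2 = Z)
    -- (P): the Faddeev–Popov weight on the fat tube, from below
    {Nlo : ℝ} (hN : ∀ U ∈ fatTubeRho L (fun b' => K * powScale s b') (fun b' => M * (K * powScale s b')) β, Nlo ≤ gaugeAvg (recordChi L s K M β) U)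
    -- radii and their smallness
    {ρ r R₁ ρ₁ : ℝ} (hρ0 : 0 ≤ ρ) (hρ5 : ρ ≤ 1 / 5) (hρε : 3 * ρ < εsp) (hρK : 3 * Ksp * ρ ≤ 1 / 8) (hR50 : ((2 + 24 * Ksp) * ρ) ^ 2 / 4 ≤ 1 / 50)
    (h1 : (4 + 48 * Ksp) * ρ < εT) (h2 : (4 + 48 * Ksp) * ρ < εL) (h3 : (4 + 48 * Ksp) * ρ < εB) (h4 : (4 + 48 * Ksp) * ρ ≤ 1 / 40) (h5 : 9 * Ksp * ρ < εT)
    (h6 : (4 + 48 * Ksp) * ρ < εC) (h7 : (4 + 48 * Ksp) * ρ < εI) (h8 : (4 + 48 * Ksp) * ρ < εD) (h9 : KD * ((4 + 48 * Ksp) * ρ) ^ 2 ≤ 1 / 2)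
    (hδ : Real.sqrt 2 * Fintype.card (Edge 3 L) * ρ < K * powScale s β) (hρf : Real.sqrt 2 * ρ < M * (K * powScale s β)) (hρ₁ : (2 + 24 * Ksp) * ρ < ρ₁)
    (hr0 : 0 ≤ r) (hrR : r ≤ R₁) (hR1 : R₁ ≤ 1 / 2) (hR1T : R₁ < εT) (hcore : ρ₁ + 8 * r ≤ M * (K * powScale s β))
    (hsupp : 3 * ((L : ℝ) - 1) * (ρ₁ + M * (K * powScale s β)) ≤ R₁) (hθ : (MT + 2 * B) * R₁ * (4 * sliceConst L) ≤ 1 / 4)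
    (hρ4 : M * (K * powScale s β) ≤ 1 / 4)
    -- the window floor, the profile radius, the chart point, the core-complement tail
    {χlo : ℝ} (hχlo0 : 0 ≤ χlo)
    (hχlo : ∀ u : GaugeConfig 3 1 SU2, (∀ k : Fin 3, ‖su2Quat (u (0, k)) - 1‖ ≤ 5 * (M * (K * powScale s β))) →
      wilsonAction su2Rep u ≤ 12 * (5 * (M * (K * powScale s β))) ^ 4 → χlo ≤ χ₀ u)
    {Rw : ℝ} (hrf : Rw + 14 * Fintype.card (Edge 3 L) * ρ ^ 2 + (CL * ((4 + 48 * Ksp) * ρ) * (9 * Ksp * ρ) + MT * (9 * Ksp * ρ) ^ 2) + (B * r + MT * r ^ 2) ≤ rf β)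
    {w : Edge 3 L → Fin 3 → ℝ} (hw : ∀ e, ∑ a, w e a ^ 2 ≤ ρ ^ 2) (hcwR : ‖chartVec w‖ ≤ Rw)
    -- step (5): the based radius and the jump radius of the Faddeev–Popov core
    (ha'3 : 9 * Ksp * ρ ≤ 1 / 3) (hboot' : 4 * sliceConst L * MT * (9 * Ksp * ρ) ≤ 1 / 2)
    (hRb3 : 3 * ((L : ℝ) - 1) * (ρ₁ + M * (K * powScale s β)) ≤ 1 / 3) (hRbT : 3 * ((L : ℝ) - 1) * (ρ₁ + M * (K * powScale s β)) < εT)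
    (hbootb : 4 * sliceConst L * MT * (3 * ((L : ℝ) - 1) * (ρ₁ + M * (K * powScale s β))) ≤ 1 / 2)
    (hjump : 32 * sliceConst L * ((Rw + 14 * Fintype.card (Edge 3 L) * ρ ^ 2) + rf β) < R₁')
    (hNT : (1 + KD * ((4 + 48 * Ksp) * ρ) ^ 2) * (4 : ℝ) ^ (flatDim L / 2 : ℝ) * Real.exp (-((1 / (4 * sliceConst L)) ^ 2 * r ^ 2 / (4 * powScale 1 β ^ 2))) *
      fpWeightBar L (powScale 1 β) ≤ Nlo) :
    Z * (χlo * Real.exp (-(((96 * t + b) * (B * r + MT * r ^ 2) * (2 * (Rw + 14 * ((Fintype.card (Edge 3 L) : ℝ)) * ρ ^ 2 + (CL * ((4 + 48 * Ksp) * ρ) * (9 * Ksp * ρ) + MT * (9 * Ksp * ρ) ^ 2)) + (B * r + MT * r ^ 2))) + ((96 * t + b) * ((CL * ((4 + 48 * Ksp) * ρ) * (9 * Ksp * ρ) + MT * (9 * Ksp * ρ) ^ 2) * (2 * (Rw + 14 * ((Fintype.card (Edge 3 L) : ℝ)) * ρ ^ 2 + (CL * ((4 + 48 * Ksp) * ρ)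 * (9 * Ksp * ρ) + MT * (9 * Ksp * ρ) ^ 2)) + (CL * ((4 + 48 * Ksp) * ρ) * (9 * Ksp * ρ) + MT * (9 * Ksp * ρ) ^ 2)) + 72 * ((Fintype.card (Edge 3 L) : ℝ)) * ρ ^ 3)))) * (Nlo - ((1 + KD * ((4 + 48 * Ksp) * ρ) ^ 2) * (4 : ℝ) ^ (flatDim L / 2 : ℝ) * Real.exp (-((1 / (4 * sliceConst L)) ^ 2 * r ^ 2 / (4 * (powScale 1 β) ^ 2))) * fpWeightBar L (powScale 1 β)))) * Real.exp (-stiffGaussExp L t b (chartVec w)) ≤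
      ∫ g, coreWeight L ε R₁' g * boFun L χ₀ (frozenProfile L qf rf β) (gaugeTransform g⁻¹ (latPatternChart L (fun _ => false) w)) ∂gaugeMeasure L := by
  set sg := powScale 1 β with hsgdef
  set c := 1 / (4 * sliceConst L) with hcdef
  set E : ℝ := (Fintype.card (Edge 3 L) : ℝ) with hEdef
  set D' := CL * ((4 + 48 * Ksp) * ρ) * (9 * Ksp * ρ) + MT * (9 * Ksp * ρ) ^ 2 with hD'def
  set X := Rw + 14 * E * ρ ^ 2 + D' with hXdef
  set D := B * r + MT * r ^ 2 with hDdef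
  set εq := (96 * t + b) * D * (2 * X + D) with hεqdef
  set εtr := (96 * t + b) * (D' * (2 * X + D') + 72 * E * ρ ^ 3) with hεtrdef
  set Tb := (1 + KD * ((4 + 48 * Ksp) * ρ) ^ 2) * (4 : ℝ) ^ (flatDim L / 2 : ℝ) * Real.exp (-(c ^ 2 * r ^ 2 / (4 * sg ^ 2))) * fpWeightBar L sg with hTbdef
  have hCχ0 : 0 ≤ Cχ := (hχ0 1).trans (hCχ 1)
  set V := latPatternChart L (fun _ => false) w with hV
  -- the representative and the transfer
  obtain ⟨c₀, ξ', p, hrep, hξ', hslice, hsc, hpn⟩ := chartPoint_slice_rep (L := L) hKsp hSP hρ0 hρ5 hρε hρK hR50 hw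
  obtain ⟨-, hqtr⟩ := chart_rep_transfer (L := L) ht hb hKsp hρ0 hρ5 hw hrep hξ' hpn hMT hT hCL hLip hB0 hB h1 h2 h3 h4 h5
  have hx'le := norm_rep_le_refined (L := L) hKsp hρ0 hρ5 hw hrep hξ' hpn hslice hMT hT hCL hLip h1 h2 h4 h5
  obtain ⟨hVfat, hpfat, havg⟩ := chartPoint_fatTube_data (L := L) (δ := fun b' => K * powScale s b') (ρf := fun b' => M * (K * powScale s b')) hKsp hρ0 hw hδ hρf hrep hsc hρ₁
  -- step (5): the core-complement part vanishes
  have hGV : ‖(gaugeModes L).starProjection (relLinkVec L (latPatternChart L (fun _ => false) w))‖ ≤ Rw + 14 * Fintype.card (Edge 3 L) * ρ ^ 2 := by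
    have e1 : relLinkVec L (latPatternChart L (fun _ => false) w) = chartVec w - (chartVec w - relLinkVec L (latPatternChart L (fun _ => false) w)) := by abel
    rw [e1, map_sub]
    refine (norm_sub_le _ _).trans (add_le_add ((Submodule.norm_starProjection_apply_le _ _).trans hcwR) (norm_proj_chartVec_sub_relLinkVec_le hρ0 hρ5 hw))
  have htail : ∫ g, (coreSet L R₁')ᶜ.indicator (fun g => boFun L χ₀ (frozenProfile L qf rf β) (gaugeTransform g⁻¹ V)) g ∂gaugeMeasure L = 0 := by
    rw [hV]
    exact integral_coreComplement_eq_zero (L := L) p hMT hT hC (lt_of_le_of_lt hpn h1) (lt_of_le_of_lt hpn h6) (hpn.trans h4) hslice hpfat.1 hrep hξ' h5 ha'3 hboot' hGV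
      (boFun_frozenProfile_support (L := L) hbo) hRb3 hRbT hbootb hjump
  rw [← hV] at hVfat havg
  set x' : LinkSpace L := linkEmbed L (p.1 : Edge 3 L → Fin 3 → ℝ) with hx'
  have hpT : ‖p‖ < εT := lt_of_le_of_lt hpn h1
  have hpC : ‖p‖ < εC := lt_of_le_of_lt hpn h6
  have hp40 : ‖p‖ ≤ 1 / 40 := hpn.trans h4
  have hpB : ‖basedLin L p‖ ≤ B := hB p (lt_of_le_of_lt hpn h3)
  have hpI : ∫ w, Real.exp (-(1 / 4 * ‖laplaceMap L p w‖ ^ 2 / sg ^ 2)) ∂(volume : Measure (NzSite L → Fin 3 → ℝ)) =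
      (π * sg ^ 2 / (1 / 4)) ^ (flatDim L / 2 : ℝ) / Real.sqrt (gramDet L p) := hI p (lt_of_le_of_lt hpn h7) (by norm_num) hs1
  have hpx : |gramDet L p / gramDet L 0 - 1| ≤ KD * ((4 + 48 * Ksp) * ρ) ^ 2 :=
    (hD p (lt_of_le_of_lt hpn h8)).trans (mul_le_mul_of_nonneg_left (pow_le_pow_left₀ (norm_nonneg _) hpn 2) hKD)
  have hCpos := sliceConst_pos L
  have hθp : (MT + 2 * ‖basedLin L p‖) * R₁ * (4 * sliceConst L) ≤ 1 / 4 := by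
    have hR10 : 0 ≤ R₁ := hr0.trans hrR
    calc (MT + 2 * ‖basedLin L p‖) * R₁ * (4 * sliceConst L) ≤ (MT + 2 * B) * R₁ * (4 * sliceConst L) := by gcongr
      _ ≤ 1 / 4 := hθ
  -- sizes
  have hXx : ‖x'‖ ≤ X := hx'le.trans (by rw [hXdef, hD'def, hEdef]; linarith [hcwR])
  have hX0 : 0 ≤ X := (norm_nonneg _).trans hXx
  have h96 : 0 ≤ 96 * t + b := by positivity
  set Dp : ℝ := ‖basedLin L p‖ * r + MT * r ^ 2 with hDp
  have hDp0 : 0 ≤ Dp := by positivity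
  have hDpD : Dp ≤ D := by
    rw [hDp, hDdef]; have := mul_le_mul_of_nonneg_right hpB hr0; linarith
  -- the indicator facts at the representative
  have hind : ∀ w' : NzSite L → Fin 3 → ℝ, ‖w'‖ ≤ r → gaugeTransform (basedExt L fun y => gnoPoint (w' y)) (tubePt L p) ∈ orthoTubeSet L ∧
      χlo ≤ χ₀ (slowMean L (gaugeTransform (basedExt L fun y => gnoPoint (w' y)) (tubePt L p))) ∧
      ‖relLinkVec L (gaugeTransform (basedExt L fun y => gnoPoint (w' y)) (tubePt L p))‖ ≤ rf β := by
    intro w' hw'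
    obtain ⟨_, htube, hsm, hS1, hrel⟩ := slice_core_indicator_facts (L := L) (δ := fun b' => K * powScale s b') (ρ := fun b' => M * (K * powScale s b')) p hMT hT hpT hp40
      hpfat hr0 (lt_of_le_of_lt hrR hR1T) (hrR.trans hR1) hcore hρ4 hw'
    refine ⟨htube, hχlo _ hsm hS1, hrel.trans ?_⟩
    rw [← hx']
    have e1 : ‖basedLin L p‖ * r + MT * r ^ 2 ≤ D := hDpD
    calc ‖x'‖ + (‖basedLin L p‖ * r + MT * r ^ 2) ≤ X + D := add_le_add hXx e1
      _ ≤ rf β := by rw [hXdef, hDdef, hD'def, hEdef]; exact hrf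
  -- the orbit lower bound at `V`
  obtain ⟨hlo, -⟩ := localisedAvg_orbit_bounds (L := L) hL hs1 p hMT hεT hT hC hpT hpC hp40 hslice hpfat hr0 hrR hR1 hR1T hcore hsupp hθp ht hb hqfm hqf0 hqfinv hqf rf hχm hχ0 hCχ
    hχinv hbo ε R₁' hZ0 hZ hχlo0 hind havg
  rw [← hx'] at hlo
  -- `ε_q(p) ≤ ε_q`, `ε_tr(p) ≤ ε_tr`
  have hεqp : (96 * t + b) * Dp * (2 * ‖x'‖ + Dp) ≤ εq := by
    rw [hεqdef]
    have := mul_le_mul hDpD (by linarith : 2 * ‖x'‖ + Dp ≤ 2 * X + D) (by positivity) (hDp0.trans hDpD)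
    calc (96 * t + b) * Dp * (2 * ‖x'‖ + Dp) = (96 * t + b) * (Dp * (2 * ‖x'‖ + Dp)) := by ring
      _ ≤ (96 * t + b) * (D * (2 * X + D)) := mul_le_mul_of_nonneg_left this h96
      _ = _ := by ring
  have hD'0 : 0 ≤ D' := by positivity
  have hεtrp : (96 * t + b) * (D' * (2 * ‖x'‖ + D') + 72 * Fintype.card (Edge 3 L) * ρ ^ 3) ≤ εtr := by
    rw [hεtrdef, hEdef]
    refine mul_le_mul_of_nonneg_left ?_ h96
    have := mul_le_mul_of_nonneg_left (by linarith [hXx] : 2 * ‖x'‖ + D' ≤ 2 * X + D') hD'0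
    linarith
  have hq := hqtr.trans hεtrp
  obtain ⟨-, hexp2⟩ := exp_neg_transfer hq   -- `e^{−ε_tr} e^{−q(chartVec w)} ≤ e^{−q(x*)}`
  have hNV : Nlo ≤ gaugeAvg (recordChi L s K M β) V := hN V hVfat
  have hTail := laplace_tail_le_fpWeightBar (L := L) hs1 p hpI hpx h9 (c ^ 2 * r ^ 2 / (4 * sg ^ 2))
  -- assemble: main term
  have hNTb : Tb ≤ Nlo := by rw [hTbdef, hcdef, hsgdef]; exact hNT
  have step1 : χlo * Real.exp (-(εq + εtr)) * (Nlo - Tb) * Real.exp (-stiffGaussExp L t b (chartVec w)) ≤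
      χlo * Real.exp (-((96 * t + b) * Dp * (2 * ‖x'‖ + Dp))) * Real.exp (-stiffGaussExp L t b x') *
        (gaugeAvg (recordChi L s K M β) V - ((2 * π ^ 2)⁻¹) ^ Fintype.card (NzSite L) * (Real.exp (-(c ^ 2 * r ^ 2 / (4 * sg ^ 2))) *
          ∫ w, Real.exp (-(1 / 4 * ‖laplaceMap L p w‖ ^ 2 / sg ^ 2)) ∂(volume : Measure (NzSite L → Fin 3 → ℝ)))) := by
    have e1 : Real.exp (-εq) ≤ Real.exp (-((96 * t + b) * Dp * (2 * ‖x'‖ + Dp))) := Real.exp_le_exp.2 (by linarith)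
    have e2 : Real.exp (-(εq + εtr)) * Real.exp (-stiffGaussExp L t b (chartVec w)) ≤ Real.exp (-((96 * t + b) * Dp * (2 * ‖x'‖ + Dp))) * Real.exp (-stiffGaussExp L t b x') := by
      calc Real.exp (-(εq + εtr)) * Real.exp (-stiffGaussExp L t b (chartVec w)) = Real.exp (-εq) * (Real.exp (-εtr) * Real.exp (-stiffGaussExp L t b (chartVec w))) := by
            rw [neg_add, Real.exp_add]; ring
        _ ≤ Real.exp (-((96 * t + b) * Dp * (2 * ‖x'‖ + Dp))) * Real.exp (-stiffGaussExp L t b x') := mul_le_mul e1 hexp2 (by positivity) (Real.exp_pos _).le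
    have e3 : Nlo - Tb ≤ gaugeAvg (recordChi L s K M β) V - ((2 * π ^ 2)⁻¹) ^ Fintype.card (NzSite L) * (Real.exp (-(c ^ 2 * r ^ 2 / (4 * sg ^ 2))) *
          ∫ w, Real.exp (-(1 / 4 * ‖laplaceMap L p w‖ ^ 2 / sg ^ 2)) ∂(volume : Measure (NzSite L → Fin 3 → ℝ))) := by
      have : ((2 * π ^ 2)⁻¹) ^ Fintype.card (NzSite L) * (Real.exp (-(c ^ 2 * r ^ 2 / (4 * sg ^ 2))) *
          ∫ w, Real.exp (-(1 / 4 * ‖laplaceMap L p w‖ ^ 2 / sg ^ 2)) ∂(volume : Measure (NzSite L → Fin 3 → ℝ))) ≤ Tb := hTail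
      linarith
    have e4 := mul_le_mul e2 e3 (by linarith) (by positivity)
    calc _ = χlo * ((Real.exp (-(εq + εtr)) * Real.exp (-stiffGaussExp L t b (chartVec w))) * (Nlo - Tb)) := by ring
      _ ≤ χlo * ((Real.exp (-((96 * t + b) * Dp * (2 * ‖x'‖ + Dp))) * Real.exp (-stiffGaussExp L t b x')) *
          (gaugeAvg (recordChi L s K M β) V - ((2 * π ^ 2)⁻¹) ^ Fintype.card (NzSite L) * (Real.exp (-(c ^ 2 * r ^ 2 / (4 * sg ^ 2))) *
            ∫ w, Real.exp (-(1 / 4 * ‖laplaceMap L p w‖ ^ 2 / sg ^ 2)) ∂(volume : Measure (NzSite L → Fin 3 → ℝ))))) := mul_le_mul_of_nonneg_left e4 hχlo0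
      _ = _ := by ring
  -- assemble
  calc _ = Z * (χlo * Real.exp (-(εq + εtr)) * (Nlo - Tb) * Real.exp (-stiffGaussExp L t b (chartVec w)) - 0) := by ring
    _ ≤ Z * (χlo * Real.exp (-((96 * t + b) * Dp * (2 * ‖x'‖ + Dp))) * Real.exp (-stiffGaussExp L t b x') *
        (gaugeAvg (recordChi L s K M β) V - ((2 * π ^ 2)⁻¹) ^ Fintype.card (NzSite L) * (Real.exp (-(c ^ 2 * r ^ 2 / (4 * sg ^ 2))) *
          ∫ w, Real.exp (-(1 / 4 * ‖laplaceMap L p w‖ ^ 2 / sg ^ 2)) ∂(volume : Measure (NzSite L → Fin 3 → ℝ)))) -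
        ∫ g, (coreSet L R₁')ᶜ.indicator (fun g => boFun L χ₀ (frozenProfile L qf rf β) (gaugeTransform g⁻¹ V)) g ∂gaugeMeasure L) := by
        rw [htail]; exact mul_le_mul_of_nonneg_left (sub_le_sub_right step1 _) hZ0
    _ ≤ _ := hlo

end Summit.QuantumFields.YangMills.Theorems.FemtoTransferGap.TwoLattice.ConstTube

end
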